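import Literature.Probability.Moments.DecorrelationExtensionCovariance
import HarnessLib

/-!
# Extending a WINDOWED decorrelation bound from indicators to bounded functions

Topic `Literature/Probability/Moments` (kind proof; no new notions; windowed twin of `DecorrelationExtension.lean` /
`DecorrelationExtensionCovariance.lean`).  The decorrelation hypothesis is assumed ONLY for measurable sets `T ⊆ D`,
`T' ⊆ D'` inside two fixed windows `D, D'` (the form in which a cluster expansion delivers it: the WINDOWED PLATEAU of the
hard-sphere rung-0 closures of `JParityClosure.EvenStressEnskog` / `RateFloor`), and the conclusions are the same for
functions supported in `D`, `D'` — the layer-cake level sets of such functions lie in the windows, so the proofs are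
verbatim those of the unwindowed file with the two inclusions threaded through:

* `abs_integral_stepSum_sub_le_window`, `abs_integral_mul_sub_le_of_indicator_window`,
* `abs_covariance_le_of_indicator_window`, `abs_covariance_le_of_indicator_of_abs_le_window`.

Reference: P. Doukhan, *Mixing: Properties and Examples*, LNS 85, Springer 1994, §1.2.2 (bounded case of the covariance
inequality for event-defined mixing coefficients). [folklore]
-/

noncomputable section

open MeasureTheory ProbabilityTheory

namespace Literature.Probability.Moments

section ExtensionWindow

variable {Ω α : Type*} [MeasurableSpace Ω] [MeasurableSpace α]
  {P : Measure Ω} [IsFiniteMeasure P] {ν : Measure α} [IsFiniteMeasure ν]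

/-- **Windowed decorrelation of decorated step functions**: as `abs_integral_stepSum_sub_le`, with the decorrelation
hypothesis only for sets inside the windows `D ⊇ T m`, `D' ⊇ T' m`. [folklore] -/
theorem abs_integral_stepSum_sub_le_window {U U' : Ω → α} (hU : Measurable U) (hU' : Measurable U')
    {H H' : Ω → ℝ} (hH : Measurable H) (hH' : Measurable H') (hH1 : ∀ ω, |H ω| ≤ 1)
    (hH'1 : ∀ ω, |H' ω| ≤ 1) {ζ : ℝ} (hζ : 0 ≤ ζ)
    {D D' : Set α}
    (hdec : ∀ T T' : Set α, MeasurableSet T → MeasurableSet T' → T ⊆ D → T' ⊆ D' →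
      |(∫ ω, H ω * T.indicator (fun _ => (1 : ℝ)) (U ω) * (H' ω * T'.indicator (fun _ => (1 : ℝ)) (U' ω)) ∂P) -
          (∫ ω, H ω * T.indicator (fun _ => (1 : ℝ)) (U ω) ∂P) *
            (∫ ω, H' ω * T'.indicator (fun _ => (1 : ℝ)) (U' ω) ∂P)| ≤ ζ * ν.real T * ν.real T')
    {n : ℕ} {T T' : ℕ → Set α} (hT : ∀ m, MeasurableSet (T m)) (hT' : ∀ m, MeasurableSet (T' m))
    (hTD : ∀ m, T m ⊆ D) (hT'D : ∀ m, T' m ⊆ D') {c c' : ℝ} (hc : 0 ≤ c) (hc' : 0 ≤ c') :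
    |(∫ ω, H ω * (∑ m ∈ Finset.range n, c * (T m).indicator (fun _ => (1 : ℝ)) (U ω)) *
          (H' ω * ∑ m ∈ Finset.range n, c' * (T' m).indicator (fun _ => (1 : ℝ)) (U' ω)) ∂P) -
        (∫ ω, H ω * ∑ m ∈ Finset.range n, c * (T m).indicator (fun _ => (1 : ℝ)) (U ω) ∂P) *
          (∫ ω, H' ω * ∑ m ∈ Finset.range n, c' * (T' m).indicator (fun _ => (1 : ℝ)) (U' ω) ∂P)|
      ≤ ζ * (n * c * ν.real D) * (n * c' * ν.real D') := by
  -- the elementary decorated indicators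
  set X : ℕ → Ω → ℝ := fun m ω => H ω * (T m).indicator (fun _ => (1 : ℝ)) (U ω) with hX
  set Y : ℕ → Ω → ℝ := fun m ω => H' ω * (T' m).indicator (fun _ => (1 : ℝ)) (U' ω) with hY
  have hind1 : ∀ (S : Set α) (a : α), |S.indicator (fun _ => (1 : ℝ)) a| ≤ 1 := fun S a => by
    by_cases h : a ∈ S
    · rw [Set.indicator_of_mem h, abs_one]
    · rw [Set.indicator_of_notMem h, abs_zero]; exact zero_le_one
  have hXm : ∀ m, Measurable (X m) := fun m => hH.mul ((measurable_const.indicator (hT m)).comp hU)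
  have hYm : ∀ m, Measurable (Y m) := fun m => hH'.mul ((measurable_const.indicator (hT' m)).comp hU')
  have hX1 : ∀ m ω, |X m ω| ≤ 1 := fun m ω => by
    simp only [hX]; rw [abs_mul]
    exact mul_le_one₀ (hH1 ω) (abs_nonneg _) (hind1 _ _)
  have hY1 : ∀ m ω, |Y m ω| ≤ 1 := fun m ω => by
    simp only [hY]; rw [abs_mul]
    exact mul_le_one₀ (hH'1 ω) (abs_nonneg _) (hind1 _ _)
  have hXint : ∀ m, Integrable (X m) P := fun m =>
    Integrable.of_bound (hXm m).aestronglyMeasurable 1 (ae_of_all _ fun ω => by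
      rw [Real.norm_eq_abs]; exact hX1 m ω)
  have hYint : ∀ m, Integrable (Y m) P := fun m =>
    Integrable.of_bound (hYm m).aestronglyMeasurable 1 (ae_of_all _ fun ω => by
      rw [Real.norm_eq_abs]; exact hY1 m ω)
  have hXYint : ∀ m m', Integrable (fun ω => X m ω * Y m' ω) P := fun m m' =>
    Integrable.of_bound ((hXm m).mul (hYm m')).aestronglyMeasurable 1 (ae_of_all _ fun ω => by
      rw [Real.norm_eq_abs, abs_mul]; exact mul_le_one₀ (hX1 m ω) (abs_nonneg _) (hY1 m' ω))
  -- rewrite the three integrands as finite sums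
  have e1 : (fun ω => H ω * (∑ m ∈ Finset.range n, c * (T m).indicator (fun _ => (1 : ℝ)) (U ω)) *
      (H' ω * ∑ m ∈ Finset.range n, c' * (T' m).indicator (fun _ => (1 : ℝ)) (U' ω))) =
      fun ω => ∑ m ∈ Finset.range n, ∑ m' ∈ Finset.range n, c * c' * (X m ω * Y m' ω) := by
    funext ω
    rw [Finset.mul_sum, Finset.mul_sum, Finset.sum_mul_sum]
    refine Finset.sum_congr rfl fun m _ => Finset.sum_congr rfl fun m' _ => ?_
    simp only [hX, hY]; ring
  have e2 : (fun ω => H ω * ∑ m ∈ Finset.range n, c * (T m).indicator (fun _ => (1 : ℝ)) (U ω)) =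
      fun ω => ∑ m ∈ Finset.range n, c * X m ω := by
    funext ω
    simp only [hX, Finset.mul_sum]
    refine Finset.sum_congr rfl fun m _ => by ring
  have e3 : (fun ω => H' ω * ∑ m ∈ Finset.range n, c' * (T' m).indicator (fun _ => (1 : ℝ)) (U' ω)) =
      fun ω => ∑ m ∈ Finset.range n, c' * Y m ω := by
    funext ω
    simp only [hY, Finset.mul_sum]
    refine Finset.sum_congr rfl fun m _ => by ring
  have i1 : ∫ ω, (∑ m ∈ Finset.range n, ∑ m' ∈ Finset.range n, c * c' * (X m ω * Y m' ω)) ∂P =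
      ∑ m ∈ Finset.range n, ∑ m' ∈ Finset.range n, c * c' * ∫ ω, X m ω * Y m' ω ∂P := by
    rw [integral_finsetSum _ fun m _ => integrable_finsetSum _ fun m' _ => (hXYint m m').const_mul _]
    refine Finset.sum_congr rfl fun m _ => ?_
    rw [integral_finsetSum _ fun m' _ => (hXYint m m').const_mul _]
    exact Finset.sum_congr rfl fun m' _ => integral_const_mul _ _
  have i2 : ∫ ω, (∑ m ∈ Finset.range n, c * X m ω) ∂P = ∑ m ∈ Finset.range n, c * ∫ ω, X m ω ∂P := by
    rw [integral_finsetSum _ fun m _ => (hXint m).const_mul _]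
    exact Finset.sum_congr rfl fun m _ => integral_const_mul _ _
  have i3 : ∫ ω, (∑ m ∈ Finset.range n, c' * Y m ω) ∂P = ∑ m ∈ Finset.range n, c' * ∫ ω, Y m ω ∂P := by
    rw [integral_finsetSum _ fun m _ => (hYint m).const_mul _]
    exact Finset.sum_congr rfl fun m _ => integral_const_mul _ _
  rw [e1, e2, e3, i1, i2, i3, Finset.sum_mul_sum, ← Finset.sum_sub_distrib]
  simp_rw [← Finset.sum_sub_distrib]
  -- each term
  have hterm : ∀ m m', |c * c' * ∫ ω, X m ω * Y m' ω ∂P - c * (∫ ω, X m ω ∂P) * (c' * ∫ ω, Y m' ω ∂P)|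
      ≤ c * c' * (ζ * ν.real D * ν.real D') := by
    intro m m'
    rw [show c * c' * ∫ ω, X m ω * Y m' ω ∂P - c * (∫ ω, X m ω ∂P) * (c' * ∫ ω, Y m' ω ∂P) =
      c * c' * ((∫ ω, X m ω * Y m' ω ∂P) - (∫ ω, X m ω ∂P) * (∫ ω, Y m' ω ∂P)) by ring, abs_mul,
      abs_of_nonneg (mul_nonneg hc hc')]
    refine mul_le_mul_of_nonneg_left ?_ (mul_nonneg hc hc')
    calc |(∫ ω, X m ω * Y m' ω ∂P) - (∫ ω, X m ω ∂P) * (∫ ω, Y m' ω ∂P)|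
        ≤ ζ * ν.real (T m) * ν.real (T' m') := hdec (T m) (T' m') (hT m) (hT' m') (hTD m) (hT'D m')
      _ ≤ ζ * ν.real D * ν.real D' :=
          mul_le_mul (mul_le_mul_of_nonneg_left (measureReal_mono (hTD m)) hζ)
            (measureReal_mono (hT'D m')) measureReal_nonneg (mul_nonneg hζ measureReal_nonneg)
  calc |∑ m ∈ Finset.range n, ∑ m' ∈ Finset.range n,
          (c * c' * ∫ ω, X m ω * Y m' ω ∂P - c * (∫ ω, X m ω ∂P) * (c' * ∫ ω, Y m' ω ∂P))|
      ≤ ∑ m ∈ Finset.range n, ∑ m' ∈ Finset.range n,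
          |c * c' * ∫ ω, X m ω * Y m' ω ∂P - c * (∫ ω, X m ω ∂P) * (c' * ∫ ω, Y m' ω ∂P)| :=
        (Finset.abs_sum_le_sum_abs _ _).trans (Finset.sum_le_sum fun m _ => Finset.abs_sum_le_sum_abs _ _)
    _ ≤ ∑ _m ∈ Finset.range n, ∑ _m' ∈ Finset.range n, c * c' * (ζ * ν.real D * ν.real D') :=
        Finset.sum_le_sum fun m _ => Finset.sum_le_sum fun m' _ => hterm m m'
    _ = ζ * (n * c * ν.real D) * (n * c' * ν.real D') := by
        rw [Finset.sum_const, Finset.sum_const, Finset.card_range, nsmul_eq_mul, nsmul_eq_mul]; ring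

/-- **Windowed decorrelation extends from indicators to nonnegative bounded functions** supported in the windows
(as `abs_integral_mul_sub_le_of_indicator`). [folklore] -/
theorem abs_integral_mul_sub_le_of_indicator_window {U U' : Ω → α} (hU : Measurable U)
    (hU' : Measurable U') {H H' : Ω → ℝ} (hH : Measurable H) (hH' : Measurable H')
    (hH1 : ∀ ω, |H ω| ≤ 1) (hH'1 : ∀ ω, |H' ω| ≤ 1) {ζ : ℝ} (hζ : 0 ≤ ζ)
    {D D' : Set α}
    (hdec : ∀ T T' : Set α, MeasurableSet T → MeasurableSet T' → T ⊆ D → T' ⊆ D' →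
      |(∫ ω, H ω * T.indicator (fun _ => (1 : ℝ)) (U ω) * (H' ω * T'.indicator (fun _ => (1 : ℝ)) (U' ω)) ∂P) -
          (∫ ω, H ω * T.indicator (fun _ => (1 : ℝ)) (U ω) ∂P) *
            (∫ ω, H' ω * T'.indicator (fun _ => (1 : ℝ)) (U' ω) ∂P)| ≤ ζ * ν.real T * ν.real T')
    {f f' : α → ℝ} (hf : Measurable f) (hf' : Measurable f') {B B' : ℝ} (hB : 0 < B) (hB' : 0 < B')
    (hf0 : ∀ a, 0 ≤ f a) (hfB : ∀ a, f a ≤ B) (hf'0 : ∀ a, 0 ≤ f' a) (hf'B : ∀ a, f' a ≤ B')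
    (hfD : ∀ a, f a ≠ 0 → a ∈ D) (hf'D : ∀ a, f' a ≠ 0 → a ∈ D') :
    |(∫ ω, H ω * f (U ω) * (H' ω * f' (U' ω)) ∂P) -
        (∫ ω, H ω * f (U ω) ∂P) * (∫ ω, H' ω * f' (U' ω) ∂P)| ≤ ζ * B * B' * ν.real D * ν.real D' := by
  set μ1 : ℝ := P.real Set.univ with hμ1
  have hμ1 : 0 ≤ μ1 := measureReal_nonneg
  refine le_of_forall_le_add_div (c := 2 * B * B' * (μ1 + μ1 * μ1)) (by positivity) fun n hn => ?_
  have hnpos : (0 : ℝ) < n := by exact_mod_cast hn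
  -- resolution and level sets
  set δ : ℝ := B / n with hδ
  set δ' : ℝ := B' / n with hδ'
  have hδ0 : 0 < δ := div_pos hB hnpos
  have hδ'0 : 0 < δ' := div_pos hB' hnpos
  have hnδ : (n : ℝ) * δ = B := by rw [hδ]; field_simp
  have hnδ' : (n : ℝ) * δ' = B' := by rw [hδ']; field_simp
  set T : ℕ → Set α := fun m => {a | ((m : ℝ) + 1) * δ ≤ f a} with hT
  set T' : ℕ → Set α := fun m => {a | ((m : ℝ) + 1) * δ' ≤ f' a} with hT'
  have hTm : ∀ m, MeasurableSet (T m) := fun m => measurableSet_le measurable_const hf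
  have hT'm : ∀ m, MeasurableSet (T' m) := fun m => measurableSet_le measurable_const hf'
  have hTD : ∀ m, T m ⊆ D := fun m a ha => hfD a (by
    have h1 : 0 < ((m : ℝ) + 1) * δ := by positivity
    exact (h1.trans_le ha).ne')
  have hT'D : ∀ m, T' m ⊆ D' := fun m a ha => hf'D a (by
    have h1 : 0 < ((m : ℝ) + 1) * δ' := by positivity
    exact (h1.trans_le ha).ne')
  -- the quantisations
  set fn : α → ℝ := fun a => ∑ m ∈ Finset.range n, δ * (T m).indicator (fun _ => (1 : ℝ)) a with hfn
  set fn' : α → ℝ := fun a => ∑ m ∈ Finset.range n, δ' * (T' m).indicator (fun _ => (1 : ℝ)) a with hfn'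
  have hfn_eq : ∀ a, fn a = ∑ m ∈ Finset.range n, if ((m : ℝ) + 1) * δ ≤ f a then δ else 0 := fun a =>
    Finset.sum_congr rfl fun m _ => by
      simp only [hT, Set.indicator_apply, Set.mem_setOf_eq, mul_ite, mul_one, mul_zero]
  have hfn'_eq : ∀ a, fn' a = ∑ m ∈ Finset.range n, if ((m : ℝ) + 1) * δ' ≤ f' a then δ' else 0 := fun a =>
    Finset.sum_congr rfl fun m _ => by
      simp only [hT', Set.indicator_apply, Set.mem_setOf_eq, mul_ite, mul_one, mul_zero]
  have hq : ∀ a, f a - δ ≤ fn a ∧ fn a ≤ f a := fun a => by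
    rw [hfn_eq]; exact sum_range_ite_le hδ0 (hf0 a) (by rw [hnδ]; exact hfB a)
  have hq' : ∀ a, f' a - δ' ≤ fn' a ∧ fn' a ≤ f' a := fun a => by
    rw [hfn'_eq]; exact sum_range_ite_le hδ'0 (hf'0 a) (by rw [hnδ']; exact hf'B a)
  -- the step-function bound
  have hstep := abs_integral_stepSum_sub_le_window hU hU' hH hH' hH1 hH'1 hζ hdec (n := n) hTm hT'm hTD hT'D
    hδ0.le hδ'0.le
  rw [hnδ, hnδ'] at hstep
  -- pointwise sizes
  have hXb : ∀ ω, |H ω * f (U ω)| ≤ B := fun ω => by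
    rw [abs_mul, abs_of_nonneg (hf0 _)]
    exact (mul_le_mul (hH1 ω) (hfB _) (hf0 _) zero_le_one).trans_eq (one_mul B)
  have hXnb : ∀ ω, |H ω * fn (U ω)| ≤ B := fun ω => by
    have h0 : 0 ≤ fn (U ω) := Finset.sum_nonneg fun m _ =>
      mul_nonneg hδ0.le (Set.indicator_nonneg (fun _ _ => zero_le_one) _)
    rw [abs_mul, abs_of_nonneg h0]
    exact (mul_le_mul (hH1 ω) ((hq _).2.trans (hfB _)) h0 zero_le_one).trans_eq (one_mul B)
  have hYb : ∀ ω, |H' ω * f' (U' ω)| ≤ B' := fun ω => by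
    rw [abs_mul, abs_of_nonneg (hf'0 _)]
    exact (mul_le_mul (hH'1 ω) (hf'B _) (hf'0 _) zero_le_one).trans_eq (one_mul B')
  have hYnb : ∀ ω, |H' ω * fn' (U' ω)| ≤ B' := fun ω => by
    have h0 : 0 ≤ fn' (U' ω) := Finset.sum_nonneg fun m _ =>
      mul_nonneg hδ'0.le (Set.indicator_nonneg (fun _ _ => zero_le_one) _)
    rw [abs_mul, abs_of_nonneg h0]
    exact (mul_le_mul (hH'1 ω) ((hq' _).2.trans (hf'B _)) h0 zero_le_one).trans_eq (one_mul B')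
  have hdX : ∀ ω, |H ω * f (U ω) - H ω * fn (U ω)| ≤ δ := fun ω => by
    rw [← mul_sub, abs_mul]
    refine (mul_le_mul (hH1 ω) ?_ (abs_nonneg _) zero_le_one).trans_eq (one_mul δ)
    rw [abs_le]; constructor <;> linarith [(hq (U ω)).1, (hq (U ω)).2]
  have hdY : ∀ ω, |H' ω * f' (U' ω) - H' ω * fn' (U' ω)| ≤ δ' := fun ω => by
    rw [← mul_sub, abs_mul]
    refine (mul_le_mul (hH'1 ω) ?_ (abs_nonneg _) zero_le_one).trans_eq (one_mul δ')
    rw [abs_le]; constructor <;> linarith [(hq' (U' ω)).1, (hq' (U' ω)).2]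
  -- measurability / integrability
  have hfnm : Measurable fn :=
    Finset.measurable_sum _ fun m _ => (measurable_const.indicator (hTm m)).const_mul _
  have hfn'm : Measurable fn' :=
    Finset.measurable_sum _ fun m _ => (measurable_const.indicator (hT'm m)).const_mul _
  have hXm : Measurable fun ω => H ω * f (U ω) := hH.mul (hf.comp hU)
  have hXnm : Measurable fun ω => H ω * fn (U ω) := hH.mul (hfnm.comp hU)
  have hYm : Measurable fun ω => H' ω * f' (U' ω) := hH'.mul (hf'.comp hU')
  have hYnm : Measurable fun ω => H' ω * fn' (U' ω) := hH'.mul (hfn'm.comp hU')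
  have hint : ∀ {g : Ω → ℝ} {C : ℝ}, Measurable g → (∀ ω, |g ω| ≤ C) → Integrable g P :=
    fun hg hgC => Integrable.of_bound hg.aestronglyMeasurable _
      (ae_of_all _ fun ω => by rw [Real.norm_eq_abs]; exact hgC ω)
  have hXYm : Measurable fun ω => H ω * f (U ω) * (H' ω * f' (U' ω)) := hXm.mul hYm
  have hXYnm : Measurable fun ω => H ω * fn (U ω) * (H' ω * fn' (U' ω)) := hXnm.mul hYnm
  have hXYb : ∀ ω, |H ω * f (U ω) * (H' ω * f' (U' ω))| ≤ B * B' := fun ω => by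
    rw [abs_mul]; exact mul_le_mul (hXb ω) (hYb ω) (abs_nonneg _) hB.le
  have hXYnb : ∀ ω, |H ω * fn (U ω) * (H' ω * fn' (U' ω))| ≤ B * B' := fun ω => by
    rw [abs_mul]; exact mul_le_mul (hXnb ω) (hYnb ω) (abs_nonneg _) hB.le
  -- the three differences
  have hd1 : |(∫ ω, H ω * f (U ω) * (H' ω * f' (U' ω)) ∂P) -
      ∫ ω, H ω * fn (U ω) * (H' ω * fn' (U' ω)) ∂P| ≤ (δ * B' + B * δ') * μ1 := by
    rw [← integral_sub (hint hXYm hXYb) (hint hXYnm hXYnb)]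
    refine abs_integral_le_mul_measureReal P fun ω => ?_
    calc |H ω * f (U ω) * (H' ω * f' (U' ω)) - H ω * fn (U ω) * (H' ω * fn' (U' ω))|
        ≤ |H ω * f (U ω) - H ω * fn (U ω)| * |H' ω * f' (U' ω)| +
            |H ω * fn (U ω)| * |H' ω * f' (U' ω) - H' ω * fn' (U' ω)| := abs_mul_sub_mul_le _ _ _ _
      _ ≤ δ * B' + B * δ' := add_le_add (mul_le_mul (hdX ω) (hYb ω) (abs_nonneg _) hδ0.le)
          (mul_le_mul (hXnb ω) (hdY ω) (abs_nonneg _) hB.le)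
  have hd3 : |(∫ ω, H ω * fn (U ω) ∂P) * (∫ ω, H' ω * fn' (U' ω) ∂P) -
      (∫ ω, H ω * f (U ω) ∂P) * (∫ ω, H' ω * f' (U' ω) ∂P)| ≤ (δ * B' + B * δ') * (μ1 * μ1) := by
    have ha : |(∫ ω, H ω * fn (U ω) ∂P) - ∫ ω, H ω * f (U ω) ∂P| ≤ δ * μ1 := by
      rw [← integral_sub (hint hXnm hXnb) (hint hXm hXb)]
      exact abs_integral_le_mul_measureReal P fun ω => by rw [abs_sub_comm]; exact hdX ω
    have hb : |(∫ ω, H' ω * fn' (U' ω) ∂P) - ∫ ω, H' ω * f' (U' ω) ∂P| ≤ δ' * μ1 := by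
      rw [← integral_sub (hint hYnm hYnb) (hint hYm hYb)]
      exact abs_integral_le_mul_measureReal P fun ω => by rw [abs_sub_comm]; exact hdY ω
    calc _ ≤ |(∫ ω, H ω * fn (U ω) ∂P) - ∫ ω, H ω * f (U ω) ∂P| * |∫ ω, H' ω * fn' (U' ω) ∂P| +
          |∫ ω, H ω * f (U ω) ∂P| * |(∫ ω, H' ω * fn' (U' ω) ∂P) - ∫ ω, H' ω * f' (U' ω) ∂P| :=
          abs_mul_sub_mul_le _ _ _ _
      _ ≤ δ * μ1 * (B' * μ1) + B * μ1 * (δ' * μ1) :=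
          add_le_add (mul_le_mul ha (abs_integral_le_mul_measureReal P hYnb) (abs_nonneg _) (by positivity))
            (mul_le_mul (abs_integral_le_mul_measureReal P hXb) hb (abs_nonneg _) (by positivity))
      _ = (δ * B' + B * δ') * (μ1 * μ1) := by ring
  -- assemble
  have hsum : (δ * B' + B * δ') * μ1 + (δ * B' + B * δ') * (μ1 * μ1) =
      2 * B * B' * (μ1 + μ1 * μ1) / n := by
    rw [hδ, hδ']; field_simp; ring
  calc |(∫ ω, H ω * f (U ω) * (H' ω * f' (U' ω)) ∂P) -
        (∫ ω, H ω * f (U ω) ∂P) * (∫ ω, H' ω * f' (U' ω) ∂P)|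
      ≤ |(∫ ω, H ω * f (U ω) * (H' ω * f' (U' ω)) ∂P) - ∫ ω, H ω * fn (U ω) * (H' ω * fn' (U' ω)) ∂P| +
        |(∫ ω, H ω * fn (U ω) * (H' ω * fn' (U' ω)) ∂P) -
            (∫ ω, H ω * fn (U ω) ∂P) * (∫ ω, H' ω * fn' (U' ω) ∂P)| +
        |(∫ ω, H ω * fn (U ω) ∂P) * (∫ ω, H' ω * fn' (U' ω) ∂P) -
            (∫ ω, H ω * f (U ω) ∂P) * (∫ ω, H' ω * f' (U' ω) ∂P)| :=
        (abs_sub_le _ _ _).trans (add_le_add (abs_sub_le _ _ _) le_rfl)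
    _ ≤ (δ * B' + B * δ') * μ1 + ζ * (B * ν.real D) * (B' * ν.real D') +
        (δ * B' + B * δ') * (μ1 * μ1) := add_le_add (add_le_add hd1 hstep) hd3
    _ = ζ * B * B' * ν.real D * ν.real D' + 2 * B * B' * (μ1 + μ1 * μ1) / n := by rw [← hsum]; ring

end ExtensionWindow

section CovarianceWindow

variable {Ω α : Type*} [MeasurableSpace Ω] [MeasurableSpace α]
  {P : Measure Ω} [IsProbabilityMeasure P] {ν : Measure α} [IsFiniteMeasure ν]

/-- **Windowed covariance form, nonnegative functions** (as `abs_covariance_le_of_indicator`). [folklore] -/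
theorem abs_covariance_le_of_indicator_window {U U' : Ω → α} (hU : Measurable U)
    (hU' : Measurable U') {H H' : Ω → ℝ} (hH : Measurable H) (hH' : Measurable H')
    (hH1 : ∀ ω, |H ω| ≤ 1) (hH'1 : ∀ ω, |H' ω| ≤ 1) {ζ : ℝ} (hζ : 0 ≤ ζ)
    {D D' : Set α}
    (hdec : ∀ T T' : Set α, MeasurableSet T → MeasurableSet T' → T ⊆ D → T' ⊆ D' →
      |(∫ ω, H ω * T.indicator (fun _ => (1 : ℝ)) (U ω) * (H' ω * T'.indicator (fun _ => (1 : ℝ)) (U' ω)) ∂P) -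
          (∫ ω, H ω * T.indicator (fun _ => (1 : ℝ)) (U ω) ∂P) *
            (∫ ω, H' ω * T'.indicator (fun _ => (1 : ℝ)) (U' ω) ∂P)| ≤ ζ * ν.real T * ν.real T')
    {f f' : α → ℝ} (hf : Measurable f) (hf' : Measurable f') {B B' : ℝ} (hB : 0 < B) (hB' : 0 < B')
    (hf0 : ∀ a, 0 ≤ f a) (hfB : ∀ a, f a ≤ B) (hf'0 : ∀ a, 0 ≤ f' a) (hf'B : ∀ a, f' a ≤ B')
    (hfD : ∀ a, f a ≠ 0 → a ∈ D) (hf'D : ∀ a, f' a ≠ 0 → a ∈ D') :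
    |cov[fun ω => H ω * f (U ω), fun ω => H' ω * f' (U' ω); P]| ≤
      ζ * B * B' * ν.real D * ν.real D' := by
  have hX2 : MemLp (fun ω => H ω * f (U ω)) 2 P :=
    memLp_two_of_abs_le' (hH.mul (hf.comp hU)) (C := B) fun ω => by
      rw [abs_mul, abs_of_nonneg (hf0 _)]
      exact (mul_le_mul (hH1 ω) (hfB _) (hf0 _) zero_le_one).trans_eq (one_mul B)
  have hY2 : MemLp (fun ω => H' ω * f' (U' ω)) 2 P :=
    memLp_two_of_abs_le' (hH'.mul (hf'.comp hU')) (C := B') fun ω => by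
      rw [abs_mul, abs_of_nonneg (hf'0 _)]
      exact (mul_le_mul (hH'1 ω) (hf'B _) (hf'0 _) zero_le_one).trans_eq (one_mul B')
  rw [covariance_eq_sub hX2 hY2]
  exact abs_integral_mul_sub_le_of_indicator_window hU hU' hH hH' hH1 hH'1 hζ hdec hf hf' hB hB' hf0 hfB
    hf'0 hf'B hfD hf'D

/-- **Windowed covariance form, signed functions** (as `abs_covariance_le_of_indicator_of_abs_le`). [folklore] -/
theorem abs_covariance_le_of_indicator_of_abs_le_window {U U' : Ω → α} (hU : Measurable U)
    (hU' : Measurable U') {H H' : Ω → ℝ} (hH : Measurable H) (hH' : Measurable H')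
    (hH1 : ∀ ω, |H ω| ≤ 1) (hH'1 : ∀ ω, |H' ω| ≤ 1) {ζ : ℝ} (hζ : 0 ≤ ζ)
    {D D' : Set α}
    (hdec : ∀ T T' : Set α, MeasurableSet T → MeasurableSet T' → T ⊆ D → T' ⊆ D' →
      |(∫ ω, H ω * T.indicator (fun _ => (1 : ℝ)) (U ω) * (H' ω * T'.indicator (fun _ => (1 : ℝ)) (U' ω)) ∂P) -
          (∫ ω, H ω * T.indicator (fun _ => (1 : ℝ)) (U ω) ∂P) *
            (∫ ω, H' ω * T'.indicator (fun _ => (1 : ℝ)) (U' ω) ∂P)| ≤ ζ * ν.real T * ν.real T')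
    {f f' : α → ℝ} (hf : Measurable f) (hf' : Measurable f') {B B' : ℝ} (hB : 0 < B) (hB' : 0 < B')
    (hfB : ∀ a, |f a| ≤ B) (hf'B : ∀ a, |f' a| ≤ B')
    (hfD : ∀ a, f a ≠ 0 → a ∈ D) (hf'D : ∀ a, f' a ≠ 0 → a ∈ D') :
    |cov[fun ω => H ω * f (U ω), fun ω => H' ω * f' (U' ω); P]| ≤
      4 * (ζ * B * B' * ν.real D * ν.real D') := by
  -- positive and negative parts
  set fp : α → ℝ := fun a => max (f a) 0 with hfp
  set fm : α → ℝ := fun a => max (-f a) 0 with hfm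
  set gp : α → ℝ := fun a => max (f' a) 0 with hgp
  set gm : α → ℝ := fun a => max (-f' a) 0 with hgm
  have hpm : ∀ (φ : α → ℝ) (C : ℝ) (E : Set α), Measurable φ → (∀ a, |φ a| ≤ C) →
      (∀ a, φ a ≠ 0 → a ∈ E) →
      (Measurable fun a => max (φ a) 0) ∧ (∀ a, 0 ≤ max (φ a) 0) ∧ (∀ a, max (φ a) 0 ≤ C) ∧
        (∀ a, max (φ a) 0 ≠ 0 → a ∈ E) := by
    intro φ C E hφ hφC hφE
    refine ⟨hφ.max measurable_const, fun a => le_max_right _ _,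
      fun a => max_le ((le_abs_self _).trans (hφC a)) ((abs_nonneg _).trans (hφC a)), fun a ha => hφE a ?_⟩
    intro h0; exact ha (by rw [h0, max_self])
  obtain ⟨hfpm, hfp0, hfpB, hfpD⟩ := hpm f B D hf hfB hfD
  obtain ⟨hfmm, hfm0, hfmB, hfmD⟩ := hpm (fun a => -f a) B D hf.neg (fun a => by rw [abs_neg]; exact hfB a)
    (fun a ha => hfD a (fun h0 => ha (by rw [h0, neg_zero])))
  obtain ⟨hgpm, hgp0, hgpB, hgpD⟩ := hpm f' B' D' hf' hf'B hf'D
  obtain ⟨hgmm, hgm0, hgmB, hgmD⟩ := hpm (fun a => -f' a) B' D' hf'.neg (fun a => by rw [abs_neg]; exact hf'B a)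
    (fun a ha => hf'D a (fun h0 => ha (by rw [h0, neg_zero])))
  -- the four decorated variables
  have h2 : ∀ (K : Ω → ℝ) (V : Ω → α) (φ : α → ℝ) (C : ℝ), Measurable K → Measurable V → Measurable φ →
      (∀ ω, |K ω| ≤ 1) → (∀ a, 0 ≤ φ a) → (∀ a, φ a ≤ C) → MemLp (fun ω => K ω * φ (V ω)) 2 P := by
    intro K V φ C hK hV hφ hK1 hφ0 hφC
    exact memLp_two_of_abs_le' (hK.mul (hφ.comp hV)) (C := C) fun ω => by
      rw [abs_mul, abs_of_nonneg (hφ0 _)]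
      exact (mul_le_mul (hK1 ω) (hφC _) (hφ0 _) zero_le_one).trans_eq (one_mul C)
  have hXp := h2 H U fp B hH hU hfpm hH1 hfp0 hfpB
  have hXm := h2 H U fm B hH hU hfmm hH1 hfm0 hfmB
  have hYp := h2 H' U' gp B' hH' hU' hgpm hH'1 hgp0 hgpB
  have hYm := h2 H' U' gm B' hH' hU' hgmm hH'1 hgm0 hgmB
  have eX : (fun ω => H ω * f (U ω)) = fun ω => H ω * fp (U ω) - H ω * fm (U ω) := by
    funext ω; rw [← mul_sub, hfp, hfm]; dsimp only; rw [max_zero_sub_max_neg_zero_eq_self]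
  have eY : (fun ω => H' ω * f' (U' ω)) = fun ω => H' ω * gp (U' ω) - H' ω * gm (U' ω) := by
    funext ω; rw [← mul_sub, hgp, hgm]; dsimp only; rw [max_zero_sub_max_neg_zero_eq_self]
  rw [eX, eY, covariance_fun_sub_fun_sub hXp hXm hYp hYm]
  have b1 := abs_covariance_le_of_indicator_window hU hU' hH hH' hH1 hH'1 hζ hdec hfpm hgpm hB hB' hfp0 hfpB
    hgp0 hgpB hfpD hgpD
  have b2 := abs_covariance_le_of_indicator_window hU hU' hH hH' hH1 hH'1 hζ hdec hfpm hgmm hB hB' hfp0 hfpB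
    hgm0 hgmB hfpD hgmD
  have b3 := abs_covariance_le_of_indicator_window hU hU' hH hH' hH1 hH'1 hζ hdec hfmm hgpm hB hB' hfm0 hfmB
    hgp0 hgpB hfmD hgpD
  have b4 := abs_covariance_le_of_indicator_window hU hU' hH hH' hH1 hH'1 hζ hdec hfmm hgmm hB hB' hfm0 hfmB
    hgm0 hgmB hfmD hgmD
  rw [abs_le] at b1 b2 b3 b4 ⊢
  constructor <;> linarith [b1.1, b1.2, b2.1, b2.2, b3.1, b3.2, b4.1, b4.2]


end CovarianceWindow

end Literature.Probability.Moments

end
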